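import Summits.AnomalousDissipation.AnomalousDissipation.Theses.MomentParity
import Summits.AnomalousDissipation.AnomalousDissipation.Theses.QuarticLadder
import Summits.AnomalousDissipation.AnomalousDissipation.Theorems.MomentParityCoupling
import Summits.AnomalousDissipation.AnomalousDissipation.Theorems.MomentParityLevelNMeasure
import Summits.AnomalousDissipation.AnomalousDissipation.Theorems.MomentParityLimit
import Summits.AnomalousDissipation.AnomalousDissipation.Theorems.MomentParitySelection
import Summits.AnomalousDissipation.AnomalousDissipation.Theorems.MomentParityTimeAverages
import Literature.Analysis.FunctionSpaces.TorusMollifiedFieldFourierBounds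
import Summits.AnomalousDissipation.AnomalousDissipation.Theorems.MomentParityGalerkinEnsembleRealizationStubLevelDissFloor
import Summits.AnomalousDissipation.AnomalousDissipation.Theorems.MomentParityGalerkinEnsembleRealizationStubTimeAverages
import Summits.AnomalousDissipation.AnomalousDissipation.Theorems.MomentParityGalerkinEnsembleRealizationStubRealisation
import Summits.AnomalousDissipation.AnomalousDissipation.Theorems.MomentParityGalerkinEnsembleRealizationStubLevelLaw
import Summits.AnomalousDissipation.AnomalousDissipation.Theorems.MomentParityGalerkinEnsembleRealizationStubLevelDissMean
import Summits.AnomalousDissipation.AnomalousDissipation.Theorems.MomentParityGalerkinEnsembleRealizationStubSupportApprox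
import Summits.AnomalousDissipation.AnomalousDissipation.Theorems.MomentParityGalerkinEnsembleRealizationStubLevelEnergyMeanTrunc

/-!
# Route MomentParity · crux `GalerkinEnsembleRealization` — the proof (line `Sketch`, restart
  variant): composition of the landed trajectory-space layer

Proof of `MomentParity.GalerkinEnsembleRealization` (stmt-AnomalousDissipation-11466; the same
decl is route QuarticLadder's binder): for `f` smooth, divergence free, mean zero and `E`, `ε > 0`
there is `M = 16‖f‖₂²E²/ε² + 1` such that for every `ν > 0`, `R`, `κ`, loud κ-resolved
Galerkin-invariant ensembles at infinitely many levels are realised by ONE global Leray–Hopf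
solution with `meanEnergy ≤ M` and `meanDissipation ≥ ε/2` (Vishik–Fursikov limit of
stationary Galerkin laws + Birkhoff + Chebyshev; Foias–Rosa–Temam 2013, Thm. 3.1 (proof);
Foias–Manley–Rosa–Temam 2001, Ch. IV App. B; Foias–Rosa–Temam 2015, Thm. 1.1;
Robinson–Rodrigo–Sadowski 2016, Thm. 4.4/4.6).

Steps (each a landed file of this route):
1. `stub_levelLaw`, `stub_levelDissMean`, `stub_levelDissFloor`, `stub_levelEnergyMeanTrunc` — the
   level-`N` ensemble pushed to the compact trajectory space `𝒦 = pathSpace R (pathLip ν A R)`: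
   a shift-invariant probability law carried by orbit paths of confined Galerkin orbits
   (`MomentParityLevelNMeasure`), with resolved-dissipation floor `ε − ν/(n+1)` (Fubini +
   invariance + the κ-clause, `ν/(n+1) ≤ ε/8`) and truncated energy ceiling `E`;
2. `exists_shiftInvariant_limit` (`MomentParityLimit`) — the shift-invariant limit law `Q`;
3. `stub_supportApprox` — every point of `supp Q` is the pointwise limit of orbit paths of
   confined Galerkin orbits of levels `→ ∞`;
4. `birkhoffAverage_dissMean_le_of_tendsto` (`MomentParityCoupling`) and
   `exists_mem_support_birkhoff_limits` (`MomentParitySelection`) — Birkhoff–Chebyshev selection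
   of a path `ω⋆ ∈ supp Q` with time-mean energy `≤ M` and time-mean resolved dissipation
   `≥ ε/2` (gap `chebyshev_gap`);
5. `stub_realisation` — the Leray–Hopf realisation of `ω⋆` after a shift by an a.e. strong time
   (`IsHopfGalerkinFamily.exists_strictMono_ae_tendsto_eLpNorm`, semigroup of the Galerkin flow,
   `IsHopfGalerkinFamily.isGlobalLerayHopf_limit`);
6. `stub_timeAverages` — from the Birkhoff limits along `ω⋆` to `meanEnergy`/`meanDissipation` of
   the realised field.
-/

noncomputable section

-- every `Summit.AnomalousDissipation.AnomalousDissipation.…` name repeats the summit = sub-problem segment (D-0017 layout)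
set_option linter.dupNamespace false

open MeasureTheory Set Filter Topology Function Metric UnitAddTorus
open scoped BigOperators ENNReal InnerProductSpace RealInnerProductSpace

namespace Summit.AnomalousDissipation.AnomalousDissipation.Theorems.MomentParity

open Literature.Analysis.FunctionSpaces Literature.Analysis.FunctionSpaces.Torus
open Literature.Analysis.FluidPDE Literature.Analysis.FluidPDE.Torus

variable {ν : ℝ} {f : UnitAddTorus (Fin 3) → EuclideanSpace ℝ (Fin 3)}

/-! ### The seven stubs

All landed and imported above: `stub_levelLaw` (`…StubLevelLaw`), `stub_levelDissMean`
(`…StubLevelDissMean`), `stub_levelDissFloor` (`…StubLevelDissFloor`), `stub_levelEnergyMeanTrunc`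
(`…StubLevelEnergyMeanTrunc`), `stub_supportApprox` (`…StubSupportApprox`), `stub_realisation`
(`…StubRealisation`), `stub_timeAverages` (`…StubTimeAverages`). -/

/-! ### Composition -/

/-- The Fourier coefficients of the truncated force are bounded by `∫ ‖f‖`. -/
theorem norm_coeffExt_fourierRestrict_le (hf : IsSmooth f) (N : ℕ) (k : Fin 3 → ℤ) :
    ‖coeffExt (freqBall N) (fourierRestrict (freqBall N) f) k‖ ≤ ∫ x, ‖f x‖ := by
  by_cases hk : k ∈ freqBall N
  · rw [coeffExt_of_mem _ hk, fourierRestrict_apply]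
    exact norm_mFourierCoeff_complexify_le_integral_norm hf.integrable k
  · rw [coeffExt_of_not_mem _ hk, norm_zero]
    exact integral_nonneg fun _ => norm_nonneg _

/-- The arithmetic of the Chebyshev gap: with `M = 16 A² E² / ε² + 1` and `ν/(n+1) ≤ ε/8`,
`ε/2 + A E / √M < ε − ν/(n+1)`. -/
theorem chebyshev_gap {A E ε δ : ℝ} (hε : 0 < ε) (hδ : δ ≤ ε / 8) :
    ε / 2 + A * E / Real.sqrt (16 * A ^ 2 * E ^ 2 / ε ^ 2 + 1) < ε - δ := by
  set M := 16 * A ^ 2 * E ^ 2 / ε ^ 2 + 1 with hM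
  have hMpos : 0 < M := by positivity
  have hsq : 0 < Real.sqrt M := Real.sqrt_pos.2 hMpos
  have key : A * E / Real.sqrt M ≤ ε / 4 := by
    by_cases hAE : A * E ≤ 0
    · exact (div_nonpos_of_nonpos_of_nonneg hAE hsq.le).trans (by positivity)
    · push Not at hAE
      rw [div_le_iff₀ hsq]
      have h1 : 4 * (A * E) / ε ≤ Real.sqrt M := by
        rw [Real.le_sqrt (by positivity) hMpos.le, hM]
        have : (4 * (A * E) / ε) ^ 2 = 16 * A ^ 2 * E ^ 2 / ε ^ 2 := by
          field_simp; ring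
        rw [this]
        linarith
      calc A * E = ε / 4 * (4 * (A * E) / ε) := by field_simp
        _ ≤ ε / 4 * Real.sqrt M := mul_le_mul_of_nonneg_left h1 (by positivity)
  linarith

/-- **`GalerkinEnsembleRealization` holds** (stmt-AnomalousDissipation-11466): loud κ-resolved
Galerkin-invariant ensembles at infinitely many levels are realised by one global Leray–Hopf solution
with `meanEnergy ≤ 16‖f‖₂²E²/ε² + 1` and `meanDissipation ≥ ε/2` — composition of the seven stubs with
the landed trajectory-space layer (see the module docstring). -/
theorem galerkinEnsembleRealization_of :
    Summit.AnomalousDissipation.AnomalousDissipation.Theses.MomentParity.GalerkinEnsembleRealization := by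
  intro f hf hdiv hf0 E ε hε
  -- the constants of the statement
  set Af : ℝ := Real.sqrt (∫ x, ‖f x‖ ^ 2) with hAf
  set M : ℝ := 16 * Af ^ 2 * E ^ 2 / ε ^ 2 + 1 with hM
  have hAf0 : 0 ≤ Af := Real.sqrt_nonneg _
  have hMpos : 0 < M := by positivity
  refine ⟨M, fun ν hν R κ hfreq => ?_⟩
  -- the resolution level: `ν/(n+1) ≤ ε/8`
  obtain ⟨n, hn⟩ : ∃ n : ℕ, ν * ((n : ℝ) + 1)⁻¹ ≤ ε / 8 := by
    obtain ⟨n, hn⟩ := exists_nat_gt (8 * ν / ε)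
    refine ⟨n, ?_⟩
    have hn1 : (0 : ℝ) < (n : ℝ) + 1 := by positivity
    rw [← div_eq_mul_inv, div_le_iff₀ hn1]
    have : 8 * ν < ε * ((n : ℝ) + 1) := by
      rw [div_lt_iff₀ hε] at hn
      nlinarith
    linarith
  set Kc : ℕ := κ n with hKc
  -- the levels along which the ensembles exist
  obtain ⟨Ns, hNs, hP⟩ := Filter.extraction_of_frequently_atTop hfreq
  choose μ hμ using hP
  have hNs_top : Tendsto Ns atTop atTop := hNs.tendsto_atTop
  -- the coefficient bound and the trajectory space
  set A : ℝ := ∫ x, ‖f x‖ with hA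
  have hA0 : 0 ≤ A := integral_nonneg fun _ => norm_nonneg _
  have hAk : ∀ j k, ‖coeffExt (freqBall (Ns j)) (fourierRestrict (freqBall (Ns j)) f) k‖ ≤ A :=
    fun j k => norm_coeffExt_fourierRestrict_le hf (Ns j) k
  set L : (Fin 3 → ℤ) → ℝ := pathLip ν A R with hL
  have hL0 : ∀ k, 0 ≤ L k := fun k => zero_le_one.trans (one_le_pathLip hA0 k)
  set ω₀ : ↥(pathSpace R L : Set (Path (Fin 3))) := ⟨0, zero_mem_pathSpace R hL0⟩ with hω₀
  -- the level laws
  haveI hprob : ∀ j, IsProbabilityMeasure (μ j) := fun j => (hμ j).1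
  have h1 := fun j => (hμ j).2.1
  have h2 := fun j => (hμ j).2.2.1
  have h3 := fun j => (hμ j).2.2.2.1
  have h4 := fun j => (hμ j).2.2.2.2.1
  have hEj := fun j => (hμ j).2.2.2.2.2.1
  have hεj := fun j => (hμ j).2.2.2.2.2.2
  set P : ℕ → Measure ↥(pathSpace R L : Set (Path (Fin 3))) := fun j =>
    ((μ j).map fun u : Torus.energySpace (Fin 3) =>
        fourierRestrict (freqBall (Ns j)) (u.1 : UnitAddTorus (Fin 3) → EuclideanSpace ℝ (Fin 3))).map
      (orbitPathOn ν (fourierRestrict (freqBall (Ns j)) f) R L ω₀) with hPdef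
  have hlaw := fun j => stub_levelLaw hν hf hf0 (hAk j) hA0 ω₀ (h1 j) (h2 j) (h4 j)
  haveI hPprob : ∀ j, IsProbabilityMeasure (P j) := fun j => (hlaw j).1
  have hθ : ∀ j, (P j).map (pathShiftOn R L (pathShift_mapsTo R L)) = P j := fun j => (hlaw j).2.1
  have hcar := fun j => (hlaw j).2.2
  have hD : ∀ j, ε - ν * ((n : ℝ) + 1)⁻¹ ≤ ∫ ω, dissMean ν Kc ω.1 ∂(P j) := fun j => by
    rw [hPdef, stub_levelDissMean hν hf hf0 (hAk j) hA0 ω₀ (h1 j) (h2 j) (h4 j) Kc]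
    exact stub_levelDissFloor hν (h1 j) (h2 j) (h3 j) (hεj j) n
  have hE : ∀ j (T : Finset (Fin 3 → ℤ)), ∫ ω, energyMeanTrunc T ω.1 ∂(P j) ≤ E := fun j T =>
    (stub_levelEnergyMeanTrunc hν hf hf0 (hAk j) hA0 ω₀ (h1 j) (h2 j) (h4 j) T).trans (hEj j)
  -- the shift-invariant limit law
  obtain ⟨Q, hQprob, hQθ, hQD, hQE, hQsupp⟩ := exists_shiftInvariant_limit R L ν Kc P hθ hD hE
  haveI := hQprob
  -- approximation of the support by Galerkin orbits
  have happrox : ∀ ω ∈ Q.support, ∃ φ : ℕ → ℕ, StrictMono φ ∧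
      ∃ c : (i : ℕ) → ↥(freqBall (Ns (φ i)) : Finset (Fin 3 → ℤ)) → EuclideanSpace ℂ (Fin 3),
        (∀ i, c i ∈ galerkinSubspace (freqBall (Ns (φ i)))) ∧
        (∀ i t, 0 ≤ t → ∑ k ∈ freqBall (Ns (φ i)), ‖coeffExt (freqBall (Ns (φ i)))
          (galerkinCoeffFlow ν (fourierRestrict (freqBall (Ns (φ i))) f) t (c i)) k‖ ^ 2 ≤ R ^ 2) ∧
        (∀ i, orbitPath ν (fourierRestrict (freqBall (Ns (φ i))) f) (c i) ∈ pathSpace R L) ∧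
        ∀ t, 0 ≤ t → ∀ k, Tendsto
          (fun i => pathExt (orbitPath ν (fourierRestrict (freqBall (Ns (φ i))) f) (c i)) t k) atTop
          (𝓝 (pathExt ω.1 t k)) := fun ω hω =>
    stub_supportApprox (g := fun j => fourierRestrict (freqBall (Ns j)) f) P hcar (hQsupp ω hω)
  -- the coupling along the support
  have hcouple : ∀ x ∈ Q.support, ∀ m : ℕ, 0 < m →
      birkhoffAverage ℝ (pathShiftOn R L (pathShift_mapsTo R L)) (fun x => dissMean ν Kc x.1) m x ≤
        (R ^ 2 / 2) / m + Af * Real.sqrt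
          (birkhoffAverage ℝ (pathShiftOn R L (pathShift_mapsTo R L)) (fun x => energyMean x.1) m x) := by
    intro x hx m hm
    obtain ⟨φ, hφ, c, hc, hconf, hmem, hlim⟩ := happrox x hx
    have h := birkhoffAverage_dissMean_le_of_tendsto hν hf Kc (hNs_top.comp hφ.tendsto_atTop)
      hc hconf hmem x.2 hlim hm
    exact h
  -- integrability and signs of the observables
  have hFe : Integrable (fun x : ↥(pathSpace R L : Set (Path (Fin 3))) => energyMean x.1) Q := by
    refine Integrable.of_bound (measurable_energyMean R L).aestronglyMeasurable (R ^ 2)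
      (ae_of_all _ fun ω => ?_)
    rw [Real.norm_eq_abs, abs_of_nonneg (energyMean_mem_Icc ω.2).1]
    exact (energyMean_mem_Icc ω.2).2
  have hFd : Integrable (fun x : ↥(pathSpace R L : Set (Path (Fin 3))) => dissMean ν Kc x.1) Q := by
    haveI : CompactSpace ↥(pathSpace R L : Set (Path (Fin 3))) := compactSpace_pathSpace R L
    exact (continuous_dissMean R L ν Kc).integrable_of_hasCompactSupport
      (HasCompactSupport.of_compactSpace _)
  have hFe0 : ∀ x : ↥(pathSpace R L : Set (Path (Fin 3))), 0 ≤ energyMean x.1 := fun x =>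
    (energyMean_mem_Icc x.2).1
  have hFd0 : ∀ x : ↥(pathSpace R L : Set (Path (Fin 3))), 0 ≤ dissMean ν Kc x.1 := fun x =>
    (dissMean_mem_Icc hν.le Kc x.2).1
  have hθQ : MeasurePreserving (pathShiftOn R L (pathShift_mapsTo R L)) Q Q :=
    ⟨(continuous_pathShiftOn R L).measurable, hQθ⟩
  have hgap : ε / 2 + Af * E / Real.sqrt M < ε - ν * ((n : ℝ) + 1)⁻¹ := chebyshev_gap hε hn
  -- Birkhoff–Chebyshev selection
  obtain ⟨x, hx, e, d, he, hd, heM, hdD⟩ := exists_mem_support_birkhoff_limits Q hθQ hFe hFd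
    hFe0 hFd0 (c₀ := R ^ 2 / 2) hAf0 hQE hQD hMpos (by positivity : (0 : ℝ) ≤ ε / 2) hgap hcouple
  -- realisation of the selected path
  obtain ⟨φ, hφ, c, hc, hconf, hmem, hlim⟩ := happrox x hx
  obtain ⟨s, hs, u, hLH, hcoef⟩ := stub_realisation hν hf (hNs_top.comp hφ.tendsto_atTop)
    hc hconf hmem x.2 hlim
  -- Birkhoff averages are integer-window means
  have he' : Tendsto (fun m : ℕ => (m : ℝ)⁻¹ * ∫ t in (0 : ℝ)..m, pathEnergyTot x.1 t) atTop (𝓝 e) := by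
    refine he.congr fun m => ?_
    rw [birkhoffAverage, birkhoffSum_energyMean, smul_eq_mul]
  have hd' : Tendsto (fun m : ℕ => (m : ℝ)⁻¹ * ∫ t in (0 : ℝ)..m, pathDiss ν Kc x.1 t) atTop (𝓝 d) := by
    refine hd.congr fun m => ?_
    rw [birkhoffAverage, birkhoffSum_dissMean, smul_eq_mul]
  obtain ⟨hEu, hDu⟩ := stub_timeAverages hν hf hf0 x.2 hs hLH hcoef Kc he' hd'
  exact ⟨u 0, u, hLH, hEu.trans heM, hdD.trans hDu⟩

/-- **Route QuarticLadder's binder** `GalerkinEnsembleRealization` (the shared ledger row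
stmt-AnomalousDissipation-11466; its body is byte-identical to MomentParity's decl), by the same
proof. -/
theorem quarticLadder_galerkinEnsembleRealization_of :
    Summit.AnomalousDissipation.AnomalousDissipation.Theses.QuarticLadder.GalerkinEnsembleRealization :=
  galerkinEnsembleRealization_of

end Summit.AnomalousDissipation.AnomalousDissipation.Theorems.MomentParity
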